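import Mathlib.RingTheory.Algebraic.Basic
import Literature.AlgebraicGeometry.Frobenioids.ArithmeticFrobenioids
import HarnessLib

/-!
# Frobenioids I, §6: Example 6.1 (A Frobenioid of geometric origin) and Theorem 6.2 (Geometric
# Frobenioids) — INTERFACE typing (v4)

Mochizuki, *The geometry of Frobenioids I: the general theory*, Kyushu J. Math. **62** (2008)
293–400, kurims text pp. 109–112 [cite: MochizukiFrdI2008, Ex. 6.1 p.109, Thm. 6.2 pp.110-111].

Setting of Ex. 6.1: `V` a proper normal geometrically integral variety over a field `k`, `K` its function
field, `K̃/K` Galois, `G = Gal(K̃/K)`, `D = B(G)⁰` (here `FinSubextCat K K̃`), `D_K` a `K̃`-`ℚ`-Cartier set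
of prime divisors; for `Spec L ∈ Ob(D)`: `V[L]` the normalisation, `D_L` the primes over `D_K`,
`Φ(L) ⊆ ℤ_{≥0}[D_L]` the Cartier effective divisors supported in `D_L`, `B(L) ⊆ L^×` the rational functions
with zeros and poles in `D_L`, `B(L) → Φ(L)^gp` "functorial in `L`". Proper normal varieties, normalisation
in a field extension and (ℚ-)Cartier divisors are NOT in Mathlib, so this data is an INTERFACE structure
`GeometricDivisorData` whose fields quote the printed description (plan/FOUNDATIONS boundary), and the
numbered claims are typed over it and over the operations `PreFrobenioidData` of the model Frobenioid
`C_{V,K̃,D_K}` (Thm. 5.2 (ii), seat abc-iut-L1-t2).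

**v2** (FLAG #14 repair; audit abc-iut-L1-t8 of p407627 F1–F3/I1; L1-lead 2026-08-25T21:13:25Z (B); fields agreed with
abc-iut-L6-t10): (1) `GeometricDivisorData` CARRIES the functoriality "in `L`" of p. 109 — along `Spec L → Spec M` (the
finite dominant `V[L] → V[M]`) we record the prime below (`over`) and the ramification index (`ram`) and DEFINE `Γ.pull σ`
(coefficient `e(Q|P) ·` coefficient at `P`; the shape of Ex. 6.3's `ArithmeticDivisorsFunctor.lean`), so `pull_id`,
`pull_comp`, `pull_injective` are theorems; `B` is carried by the field map (`map_mem`, `mapB`); `div` is natural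
(`div_natural`) and lands in `Φ(L)^gp` (`div_mem_gp`). (2) `GeometricModelFrobenioid`: `Φ(Spec L) ≅ Φ(L)` is an
isomorphism of monoids ON `D` (`monEquiv_natural`), whence `GeometricModelFrobenioid.pull_injective`. (3) `Ex61_units`
gains the printed clause `O^▷(A) = O^×(A)` (F2). (4) SCHEMA labels (W2-8 (5)) on statements over data-only parameters
(F3). (5) Thm. 6.2 (ii): v1's content-free `Thm62ii p ΨFrob naiveFrob := Nonempty (ΨFrob ≅ naiveFrob)` (F1) is
WITHDRAWN; the interface-level content of (ii) ("raising to the `p`-th power", p. 111) is `frobeniusPhi` / `frobeniusB` /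
`div_frobeniusB`, and `Thm62ii` proper lives in abc-iut-L6-t10's `GeometricFrobenioidModel.lean` (over
`geomFrobenioid Γ := ModelFrobenioid …` and abc-iut-L1-t2's `PreFrobenioid.naiveFrobeniusOf`). **v3**: the standing
hypothesis `D_K ≠ ∅` of Thm. 6.2 (`primeDiv_nonempty`, `exists_phi_ne_zero`). **v4** (S3-F1 / F5, abc-iut-L6-t10's
witness `Φ = ⟨2P, 3P⟩`: v3 admitted non-saturated `Φ(L)`, so "`Φ` divisorial", p. 109, was not derivable): the field
`sub_mem` records `Φ(L)` = the Cartier divisors (`Φ(L)^gp`, p. 109) that are effective, `Φ(L) = Φ(L)^gp ∩ ℤ_{≥0}[D_L]`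
(`V[L]` normal). Rem. 6.2.1 is prose.
-/

noncomputable section

namespace Literature.AlgebraicGeometry.Frobenioids

open CategoryTheory

universe u v

/-! ### Pull-back of coefficient vectors along a map of primes with ramification indices -/

namespace DivisorCoeff

variable {α β : Type*}

/-- Pull-back of finitely supported coefficient vectors along a finite-fibred map of primes `over : β → α`
("the prime below") with multiplicities `ram` ("ramification index"): `(pull D)(Q) = e(Q) · D(over Q)` — the
Weil-divisor coefficients of the pull-back of a Cartier divisor along a finite dominant morphism of normal
varieties (Ex. 6.1 p. 109 "pulling back divisors"; same formula as Ex. 6.3's arithmetic pull-back).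
[cite: MochizukiFrdI2008, Ex. 6.1 p.109] -/
def pull (over : β → α) (ram : β → ℕ) (hfin : ∀ a, {b | over b = a}.Finite) {R : Type*} [Semiring R] :
    (α →₀ R) →+ (β →₀ R) where
  toFun D := Finsupp.ofSupportFinite (fun b => (ram b : R) * D (over b)) (by
    refine ((D.support.finite_toSet.biUnion fun a _ => hfin a)).subset ?_
    intro b hb
    simp only [Function.mem_support, ne_eq] at hb
    simp only [Set.mem_iUnion, Set.mem_setOf_eq, Finset.mem_coe, Finsupp.mem_support_iff]
    exact ⟨over b, fun h => hb (by rw [h, mul_zero]), rfl⟩)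
  map_zero' := Finsupp.ext fun b => by simp [Finsupp.ofSupportFinite_coe]
  map_add' D E := Finsupp.ext fun b => by simp [Finsupp.ofSupportFinite_coe, mul_add]

/-- Coefficients of the pull-back. [cite: MochizukiFrdI2008, Ex. 6.1 p.109] -/
@[simp] theorem pull_apply (over : β → α) (ram : β → ℕ) (hfin : ∀ a, {b | over b = a}.Finite)
    {R : Type*} [Semiring R] (D : α →₀ R) (b : β) : pull over ram hfin D b = (ram b : R) * D (over b) := rfl

/-- Pull-back along a SURJECTIVE map of primes with POSITIVE ramification indices is injective (used with
`R = ℕ, ℤ`). [cite: MochizukiFrdI2008, Ex. 6.1 p.109] -/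
theorem pull_injective {over : β → α} {ram : β → ℕ} (hsurj : Function.Surjective over)
    (hpos : ∀ b, 0 < ram b) (hfin : ∀ a, {b | over b = a}.Finite)
    {R : Type*} [Semiring R] [IsLeftCancelMulZero R] [CharZero R] :
    Function.Injective (pull over ram hfin (R := R)) := by
  intro D E h
  ext a
  obtain ⟨b, rfl⟩ := hsurj a
  have hb := DFunLike.congr_fun h b
  simp only [pull_apply] at hb
  exact mul_left_cancel₀ (Nat.cast_ne_zero.mpr (hpos b).ne') hb

/-- `ℤ_{≥0}[D_L] ⊆ ℤ[D_L]`: effective coefficient vectors as integral ones. [cite: MochizukiFrdI2008, Ex. 6.1 p.109] -/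
def toInt : (α →₀ ℕ) →+ (α →₀ ℤ) := Finsupp.mapRange.addMonoidHom (Nat.castAddMonoidHom ℤ)

/-- Coefficients of `toInt`. [cite: MochizukiFrdI2008, Ex. 6.1 p.109] -/
@[simp] theorem toInt_apply (D : α →₀ ℕ) (a : α) : toInt D a = (D a : ℤ) := by simp [toInt]

end DivisorCoeff

section Ex61

variable (k : Type) [Field k] (K : Type) [Field K] [Algebra k K] (Kt : Type) [Field Kt] [Algebra K Kt]
  [Algebra k Kt]

/-- INTERFACE for the data of Ex. 6.1 (FrdI p. 109): for each `Spec L ∈ Ob(B(G)⁰)` the set `D_L` of prime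
divisors of the normalisation `V[L]` over `D_K`, the monoid `Φ(L) ⊆ ℤ_{≥0}[D_L]` of Cartier effective
divisors supported in `D_L`, the group `B(L) ⊆ L^×` of rational functions with zeros and poles in `D_L`
with its divisor map `B(L) → Φ(L)^gp ⊆ ℤ[D_L]` ("zeroes minus poles"), the hypothesis "`D_K` is
`K̃`-`ℚ`-Cartier" (every prime divisor in `D_L` is `ℚ`-Cartier, so that `Φ(L)^pf = ℚ_{≥0}[D_L]`), and — v2 —
the functoriality "in `L`" (p. 109 "the assignments `L ↦ Φ(L)`, `L ↦ B(L)` determine … monoids on `D` …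
`B → Φ^gp` [a homomorphism of monoids on `D`]"): along `σ : Spec L → Spec M` (the finite dominant map
`V[L] → V[M]`) each prime `Q ∈ D_L` lies over a prime `over σ Q ∈ D_M` with ramification index
`ram σ Q ≥ 1`, finitely many `Q` over each `P` and at least one; the pull-back of divisors DEFINED from this
(`GeometricDivisorData.pull`, coefficient `e(Q|P) ·` coefficient at `P`) carries `Φ(M)` into `Φ(L)`; `B(M)` is
carried into `B(L)` by the field map; `div` is natural and lands in `Φ(L)^gp`; and (v3) the standing
hypothesis "`D_K ≠ ∅`" of Thm. 6.2 (p. 110). Not typed as separate claims: "`Φ(L)` is perf-factorial", "the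
supports of elements of `Φ(L)` are the finite subsets of `D_L`". [cite: MochizukiFrdI2008, Ex. 6.1 p.109] -/
structure GeometricDivisorData where
  /-- `D_L`, the prime divisors of `V[L]` mapping into prime divisors of `D_K` -/
  primeDiv : FinSubextCat K Kt → Type
  /-- `Φ(L) ⊆ ℤ_{≥0}[D_L]`: Cartier effective divisors with support in `D_L` -/
  Phi : ∀ X : FinSubextCat K Kt, AddSubmonoid (primeDiv X →₀ ℕ)
  /-- `B(L) ⊆ L^×`: rational functions whose zeros and poles lie in `D_L` -/
  B : ∀ X : FinSubextCat K Kt, Subgroup (X.L)ˣ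
  /-- the divisor of a rational function, `B(L) → Φ(L)^gp ⊆ ℤ[D_L]` (zeros minus poles) -/
  div : ∀ X : FinSubextCat K Kt, B X →* Multiplicative (primeDiv X →₀ ℤ)
  /-- v2: the prime `P ∈ D_M` below a prime `Q ∈ D_L` along `σ : Spec L → Spec M` (image under the finite
  map `V[L] → V[M]`) -/
  over : ∀ {X Y : FinSubextCat K Kt}, (Y ⟶ X) → primeDiv Y → primeDiv X
  /-- v2: the ramification index `e(Q | over σ Q)` of `V[L] → V[M]` at the prime divisor `Q` -/
  ram : ∀ {X Y : FinSubextCat K Kt}, (Y ⟶ X) → primeDiv Y → ℕ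
  /-- ramification indices are `≥ 1` -/
  ram_pos : ∀ {X Y : FinSubextCat K Kt} (σ : Y ⟶ X) (Q : primeDiv Y), 0 < ram σ Q
  /-- finitely many primes of `V[L]` lie over a given prime of `V[M]` -/
  over_finite : ∀ {X Y : FinSubextCat K Kt} (σ : Y ⟶ X) (P : primeDiv X), {Q : primeDiv Y | over σ Q = P}.Finite
  /-- some prime of `V[L]` lies over each prime of `D_M` (`V[L] → V[M]` is finite surjective) -/
  over_surjective : ∀ {X Y : FinSubextCat K Kt} (σ : Y ⟶ X), Function.Surjective (over σ)
  /-- functoriality: the identity map -/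
  over_id : ∀ (X : FinSubextCat K Kt) (Q : primeDiv X), over (𝟙 X) Q = Q
  /-- functoriality: the identity map is unramified -/
  ram_id : ∀ (X : FinSubextCat K Kt) (Q : primeDiv X), ram (𝟙 X) Q = 1
  /-- functoriality: primes below compose -/
  over_comp : ∀ {X Y Z : FinSubextCat K Kt} (τ : Z ⟶ Y) (σ : Y ⟶ X) (Q : primeDiv Z),
    over (τ ≫ σ) Q = over σ (over τ Q)
  /-- functoriality: ramification indices multiply in towers -/
  ram_comp : ∀ {X Y Z : FinSubextCat K Kt} (τ : Z ⟶ Y) (σ : Y ⟶ X) (Q : primeDiv Z),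
    ram (τ ≫ σ) Q = ram τ Q * ram σ (over τ Q)
  /-- the pull-back of a Cartier effective divisor supported in `D_M` is a Cartier effective divisor supported
  in `D_L` ("`Φ` is a monoid on `D`") -/
  pull_mem : ∀ {X Y : FinSubextCat K Kt} (σ : Y ⟶ X) (D : primeDiv X →₀ ℕ), D ∈ Phi X →
    DivisorCoeff.pull (over σ) (ram σ) (over_finite σ) D ∈ Phi Y
  /-- the field map `M → L` carries `B(M)` into `B(L)` ("`B` is a monoid on `D`") -/
  map_mem : ∀ {X Y : FinSubextCat K Kt} (σ : Y ⟶ X) (f : (X.L)ˣ), f ∈ B X →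
    Units.map (σ.toAlgHom : X.L →* Y.L) f ∈ B Y
  /-- `div` is natural: `div(f|_{V[L]}) = σ^* div(f)` ("`B → Φ^gp` is a homomorphism of monoids on `D`") -/
  div_natural : ∀ {X Y : FinSubextCat K Kt} (σ : Y ⟶ X) (f : B X),
    Multiplicative.toAdd (div Y ⟨Units.map (σ.toAlgHom : X.L →* Y.L) f, map_mem σ f f.2⟩) =
      DivisorCoeff.pull (over σ) (ram σ) (over_finite σ) (Multiplicative.toAdd (div X f))
  /-- `div` lands in `Φ(L)^gp ⊆ ℤ[D_L]`: the divisor of `f ∈ B(L)` is a difference of two Cartier effective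
  divisors supported in `D_L` -/
  div_mem_gp : ∀ (X : FinSubextCat K Kt) (f : B X), ∃ D ∈ Phi X, ∃ E ∈ Phi X,
    Multiplicative.toAdd (div X f) = DivisorCoeff.toInt D - DivisorCoeff.toInt E
  /-- "`D_K` is `K̃`-`ℚ`-Cartier": every prime divisor in `D_L` has a Cartier multiple -/
  qCartier : ∀ (X : FinSubextCat K Kt) (P : primeDiv X), ∃ n : ℕ, 0 < n ∧ Finsupp.single P n ∈ Phi X
  /-- v4: `Φ(L)` is SATURATED in `ℤ_{≥0}[D_L]` ("`Φ(L)^gp ⊆ ℤ[D_L]` may be identified with the group of Cartier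
  divisors on `V[L]`", p. 109; `V[L]` normal, so effective Cartier = Cartier and effective): `E ≤ D` in `Φ(L) ⇒ D − E ∈ Φ(L)` -/
  sub_mem : ∀ (X : FinSubextCat K Kt) (D E : primeDiv X →₀ ℕ), D ∈ Phi X → E ∈ Phi X → E ≤ D → D - E ∈ Phi X
  /-- v3: "`D_K ≠ ∅`" — the standing hypothesis of Thm. 6.2 (p. 110; p. 111 "`C` is not of group-like type is
  immediate from our assumption that `D_K ≠ ∅`"): some `D_L` is nonempty (equivalently all, by `over`) -/
  primeDiv_nonempty : ∃ X : FinSubextCat K Kt, Nonempty (primeDiv X)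

variable {k K Kt}

namespace GeometricDivisorData

variable (Γ : GeometricDivisorData K Kt)

/-- **The pull-back of divisors** `σ^* : R[D_M] → R[D_L]` along `σ : Spec L → Spec M` (any coefficients
`R`; `R = ℕ` on `ℤ_{≥0}[D]`, `R = ℤ` on `ℤ[D] ⊇ Φ^gp`): coefficient at `Q` = `e(Q|P) ·` coefficient at
`P = over σ Q` (FrdI Ex. 6.1 p. 109 "pulling back divisors", "functorial in `L`").
[cite: MochizukiFrdI2008, Ex. 6.1 p.109] -/
def pull {X Y : FinSubextCat K Kt} (σ : Y ⟶ X) {R : Type*} [Semiring R] :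
    (Γ.primeDiv X →₀ R) →+ (Γ.primeDiv Y →₀ R) :=
  DivisorCoeff.pull (Γ.over σ) (Γ.ram σ) (Γ.over_finite σ)

/-- Coefficients of `σ^* D`. [cite: MochizukiFrdI2008, Ex. 6.1 p.109] -/
@[simp] theorem pull_apply {X Y : FinSubextCat K Kt} (σ : Y ⟶ X) {R : Type*} [Semiring R]
    (D : Γ.primeDiv X →₀ R) (Q : Γ.primeDiv Y) : Γ.pull σ D Q = (Γ.ram σ Q : R) * D (Γ.over σ Q) := rfl

/-- **Functoriality** `id^* = id` (PROVED from `over_id`, `ram_id`). [cite: MochizukiFrdI2008, Ex. 6.1 p.109] -/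
theorem pull_id (X : FinSubextCat K Kt) {R : Type*} [Semiring R] (D : Γ.primeDiv X →₀ R) :
    Γ.pull (𝟙 X) D = D := by
  ext Q
  rw [pull_apply, Γ.over_id, Γ.ram_id, Nat.cast_one, one_mul]

/-- **Functoriality** `(σ ∘ τ)^* = τ^* ∘ σ^*` (PROVED from `over_comp`, `ram_comp`).
[cite: MochizukiFrdI2008, Ex. 6.1 p.109] -/
theorem pull_comp {X Y Z : FinSubextCat K Kt} (τ : Z ⟶ Y) (σ : Y ⟶ X) {R : Type*} [Semiring R]
    (D : Γ.primeDiv X →₀ R) : Γ.pull (τ ≫ σ) D = Γ.pull τ (Γ.pull σ D) := by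
  ext Q
  rw [pull_apply, pull_apply, pull_apply, Γ.over_comp, Γ.ram_comp, Nat.cast_mul, mul_assoc]

/-- **Pull-back of divisors is injective** (PROVED: some prime lies over each prime, with positive
ramification index) — the input of the Div-slimness criterion of Thm. 6.2 (iv) (abc-iut-L6-t10's
`FinSubextCat.PullInjective`). [cite: MochizukiFrdI2008, Thm. 6.2 (iv) p.112] -/
theorem pull_injective {X Y : FinSubextCat K Kt} (σ : Y ⟶ X) {R : Type*} [Semiring R]
    [IsLeftCancelMulZero R] [CharZero R] : Function.Injective (Γ.pull σ (R := R)) :=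
  DivisorCoeff.pull_injective (Γ.over_surjective σ) (Γ.ram_pos σ) (Γ.over_finite σ)

/-- Pull-back commutes with `ℤ_{≥0}[D] ⊆ ℤ[D]`. [cite: MochizukiFrdI2008, Ex. 6.1 p.109] -/
theorem pull_toInt {X Y : FinSubextCat K Kt} (σ : Y ⟶ X) (D : Γ.primeDiv X →₀ ℕ) :
    Γ.pull σ (DivisorCoeff.toInt D) = DivisorCoeff.toInt (Γ.pull σ D) := by
  ext Q; simp [Nat.cast_mul]

/-- **`Φ` is a monoid on `D`**: the pull-back `σ^* : Φ(M) → Φ(L)` (restriction of `Γ.pull σ` by `pull_mem`),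
multiplicative notation as in `Monoids.lean`. [cite: MochizukiFrdI2008, Ex. 6.1 p.109] -/
def pullPhi {X Y : FinSubextCat K Kt} (σ : Y ⟶ X) : Multiplicative (Γ.Phi X) →* Multiplicative (Γ.Phi Y) :=
  AddMonoidHom.toMultiplicative
    ((((Γ.pull σ).restrict (Γ.Phi X)).codRestrict (Γ.Phi Y) fun D => Γ.pull_mem σ D.1 D.2))

/-- Underlying coefficient vector of `σ^* D` for `D ∈ Φ(M)`. [cite: MochizukiFrdI2008, Ex. 6.1 p.109] -/
@[simp] theorem coe_toAdd_pullPhi {X Y : FinSubextCat K Kt} (σ : Y ⟶ X) (x : Multiplicative (Γ.Phi X)) :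
    ((Multiplicative.toAdd (Γ.pullPhi σ x) : Γ.Phi Y) : Γ.primeDiv Y →₀ ℕ) =
      Γ.pull σ ((Multiplicative.toAdd x : Γ.Phi X) : Γ.primeDiv X →₀ ℕ) := rfl

/-- `id^* = id` on `Φ`. [cite: MochizukiFrdI2008, Ex. 6.1 p.109] -/
theorem pullPhi_id (X : FinSubextCat K Kt) (x : Multiplicative (Γ.Phi X)) : Γ.pullPhi (𝟙 X) x = x :=
  Multiplicative.toAdd.injective (Subtype.ext (by rw [coe_toAdd_pullPhi, pull_id]))

/-- `(σ ∘ τ)^* = τ^* ∘ σ^*` on `Φ`. [cite: MochizukiFrdI2008, Ex. 6.1 p.109] -/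
theorem pullPhi_comp {X Y Z : FinSubextCat K Kt} (τ : Z ⟶ Y) (σ : Y ⟶ X) (x : Multiplicative (Γ.Phi X)) :
    Γ.pullPhi (τ ≫ σ) x = Γ.pullPhi τ (Γ.pullPhi σ x) :=
  Multiplicative.toAdd.injective (Subtype.ext (by
    rw [coe_toAdd_pullPhi, coe_toAdd_pullPhi, coe_toAdd_pullPhi, pull_comp]))

/-- `σ^*` is injective on `Φ(M)`. [cite: MochizukiFrdI2008, Thm. 6.2 (iv) p.112] -/
theorem pullPhi_injective {X Y : FinSubextCat K Kt} (σ : Y ⟶ X) : Function.Injective (Γ.pullPhi σ) :=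
  fun x y h => Multiplicative.toAdd.injective (Subtype.ext (Γ.pull_injective σ (R := ℕ) (by
    simpa only [coe_toAdd_pullPhi] using
      congrArg (fun z => ((Multiplicative.toAdd z : Γ.Phi Y) : Γ.primeDiv Y →₀ ℕ)) h)))

/-- **`B` is a monoid on `D`**: `B(M) → B(L)`, `f ↦ f|_{V[L]}` (the field map on units, by `map_mem`).
[cite: MochizukiFrdI2008, Ex. 6.1 p.109] -/
def mapB {X Y : FinSubextCat K Kt} (σ : Y ⟶ X) : Γ.B X →* Γ.B Y :=
  ((Units.map (σ.toAlgHom : X.L →* Y.L)).restrict (Γ.B X)).codRestrict (Γ.B Y) fun f => Γ.map_mem σ f.1 f.2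

/-- `mapB σ f` is `σ(f)`. [cite: MochizukiFrdI2008, Ex. 6.1 p.109] -/
@[simp] theorem coe_mapB {X Y : FinSubextCat K Kt} (σ : Y ⟶ X) (f : Γ.B X) :
    (((Γ.mapB σ f : Γ.B Y) : (Y.L)ˣ) : Y.L) = σ.toAlgHom (((f : Γ.B X) : (X.L)ˣ) : X.L) := rfl

/-- `B(id) = id`. [cite: MochizukiFrdI2008, Ex. 6.1 p.109] -/
theorem mapB_id (X : FinSubextCat K Kt) (f : Γ.B X) : Γ.mapB (𝟙 X) f = f :=
  Subtype.ext (Units.ext rfl)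

/-- `B(σ ∘ τ) = B(τ) ∘ B(σ)`. [cite: MochizukiFrdI2008, Ex. 6.1 p.109] -/
theorem mapB_comp {X Y Z : FinSubextCat K Kt} (τ : Z ⟶ Y) (σ : Y ⟶ X) (f : Γ.B X) :
    Γ.mapB (τ ≫ σ) f = Γ.mapB τ (Γ.mapB σ f) :=
  Subtype.ext (Units.ext rfl)

/-- **`B → Φ^gp` is a homomorphism of monoids on `D`**: `div(σ f) = σ^* div(f)` (the field `div_natural`).
[cite: MochizukiFrdI2008, Ex. 6.1 p.109] -/
theorem div_mapB {X Y : FinSubextCat K Kt} (σ : Y ⟶ X) (f : Γ.B X) :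
    Multiplicative.toAdd (Γ.div Y (Γ.mapB σ f)) = Γ.pull σ (Multiplicative.toAdd (Γ.div X f)) :=
  Γ.div_natural σ f

/-- **Theorem 6.2 (ii)**, the data induced by the Frobenius morphism `ψ : V → V` in characteristic `p` via (i)
("both functors are obtained by raising to the `p`-th power", proof p. 111): on `Φ(L)` the pull-back along
Frobenius is `D ↦ p · D` (the base functor `D → D` is the identity, `L = K · L^p` for `L/K` separable).
[cite: MochizukiFrdI2008, Thm. 6.2 (ii) p.111] -/
def frobeniusPhi (p : ℕ) (X : FinSubextCat K Kt) : Multiplicative (Γ.Phi X) →* Multiplicative (Γ.Phi X) :=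
  powMonoidHom p

/-- **Theorem 6.2 (ii)**, Frobenius data on `B(L)`: `f ↦ ψ^* f = f^p`. [cite: MochizukiFrdI2008, Thm. 6.2 (ii) p.111] -/
def frobeniusB (p : ℕ) (X : FinSubextCat K Kt) : Γ.B X →* Γ.B X := powMonoidHom p

/-- The Frobenius data are compatible with `div`: `div(f^p) = p · div(f)` — the compatibility required of the
natural transformations `Φ → Φ|_D`, `B → B|_D` in Thm. 6.2 (i) (PROVED). [cite: MochizukiFrdI2008, Thm. 6.2 (ii) p.111] -/
theorem div_frobeniusB (p : ℕ) (X : FinSubextCat K Kt) (f : Γ.B X) :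
    Γ.div X (Γ.frobeniusB p X f) = Γ.div X f ^ p :=
  map_pow (Γ.div X) f p

/-- `Φ` is nonzero: some `Φ(L)` has a nonzero element (from `D_K ≠ ∅` and `qCartier`) — the input of "`C` is not
of group-like type" in Thm. 6.2 (iii) (p. 111). [cite: MochizukiFrdI2008, Thm. 6.2 (iii) p.111] -/
theorem exists_phi_ne_zero : ∃ (X : FinSubextCat K Kt) (D : Γ.Phi X), (D : Γ.primeDiv X →₀ ℕ) ≠ 0 := by
  obtain ⟨X, ⟨P⟩⟩ := Γ.primeDiv_nonempty
  obtain ⟨n, hn, hmem⟩ := Γ.qCartier X P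
  exact ⟨X, ⟨_, hmem⟩, Finsupp.single_ne_zero.mpr hn.ne'⟩

end GeometricDivisorData

variable (Γ : GeometricDivisorData K Kt)

/-- **Example 6.1**, claim "there is a natural bijection `Prime(Φ(L)) ≃ D_L`" (FrdI p. 109), typed as the
EXPLICIT map: for each prime divisor `P ∈ D_L` the Cartier multiples `n · P ∈ Φ(L)` (`qCartier`) are primary
elements of the monoid `Φ(L)` (`Monoids.lean`), all in one `≼`-class, and `P ↦` that class is a bijection
`D_L → Prime(Φ(L))` (audit F5: not a bare cardinality statement). [cite: MochizukiFrdI2008, Ex. 6.1 p.109] -/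
def Ex61_primes : Prop :=
  ∀ X : FinSubextCat K Kt,
    ∃ cls : Γ.primeDiv X → Primes (Multiplicative (Γ.Phi X)),
      Function.Bijective cls ∧
        ∀ (P : Γ.primeDiv X) (n : ℕ) (hn : Finsupp.single P n ∈ Γ.Phi X), 0 < n →
          ∃ h : IsPrimary (Multiplicative.ofAdd (⟨Finsupp.single P n, hn⟩ : Γ.Phi X)),
            cls P = Quotient.mk (primarySetoid _) ⟨_, h⟩

/-- **Example 6.1**, claim "`O^×(A) = O^▷(A) = k_L^×`, where `k_L` denotes the algebraic closure of `k` in `L`"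
(FrdI p. 110, "since `V[L]` is a proper normal variety"), typed as two clauses about `f ∈ B(L)` (in the model
Frobenioid `O^▷(A)`, resp. `O^×(A)`, of an object over `Spec L` is the set of `f ∈ B(L)` whose divisor lies in
`Φ(L)`, resp. is `0`): (`O^× = k_L^×`) `div(f) = 0` iff `f` is algebraic over `k`; (`O^▷ = O^×`, v2, audit F2)
if `div(f)` is a Cartier effective divisor [`∈ Φ(L)`] then `div(f) = 0`. SCHEMA (W2-8 (5)) over the interface
`Γ` (free `div`, `B`) — faithful to print only for THE geometric data of a proper normal variety; not a closed
citable fact. [cite: MochizukiFrdI2008, Ex. 6.1 p.110] -/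
def Ex61_units : Prop :=
  ∀ (X : FinSubextCat K Kt) (f : Γ.B X),
    (Γ.div X f = 1 ↔ IsAlgebraic k (((f : (X.L)ˣ) : X.L) : Kt)) ∧
      ((∃ D ∈ Γ.Phi X, Multiplicative.toAdd (Γ.div X f) = DivisorCoeff.toInt D) → Γ.div X f = 1)

end Ex61

/-! ### Theorem 6.2 (Geometric Frobenioids) -/

section Thm62

variable {K : Type} [Field K] {Kt : Type} [Field Kt] [Algebra K Kt]

/-- The model Frobenioid `C = C_{V,K̃,D_K}` of Thm. 5.2 (ii) attached to geometric divisor data, through its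
operations over `D = B(G)⁰` with `Φ(Spec L) ≅ Φ(L)` AS MONOIDS ON `D` (v2: `monEquiv_natural`, compatibility
with pull-backs). INTERFACE (data-only PARAMETER of the statements below; THE instance is abc-iut-L6-t10's
`geomModelFrobenioid Γ` over `geomFrobenioid Γ := ModelFrobenioid …`, `GeometricFrobenioidModel.lean`).
[cite: MochizukiFrdI2008, Thm. 6.2 p.110] -/
structure GeometricModelFrobenioid (Γ : GeometricDivisorData K Kt) (C : Type u) [Category.{v} C] where
  /-- the operations `(Base, Div, deg_Fr)` -/
  ops : PreFrobenioidData.{0} C (FinSubextCat K Kt)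
  /-- `Φ(Spec L)` is the monoid of Cartier effective divisors supported in `D_L` -/
  monEquiv : ∀ X : FinSubextCat K Kt, ops.Mon X ≃* Multiplicative (Γ.Phi X)
  /-- v2: the identification is compatible with pull-backs (an isomorphism of monoids on `D`) -/
  monEquiv_natural : ∀ {X Y : FinSubextCat K Kt} (σ : Y ⟶ X) (x : ops.Mon X),
    monEquiv Y (ops.pull σ x) = Γ.pullPhi σ (monEquiv X x)

variable {Γ : GeometricDivisorData K Kt} {C : Type u} [Category.{v} C] (M : GeometricModelFrobenioid Γ C)

/-- Pull-back of divisors in the model is injective along every morphism of `D` (PROVED from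
`monEquiv_natural` and `GeometricDivisorData.pull_injective`) — the hypothesis `FinSubextCat.PullInjective M.ops`
of abc-iut-L6-t10's `Thm62iv_of_pullInjective`, now discharged for every instance of the interface.
[cite: MochizukiFrdI2008, Thm. 6.2 (iv) p.112] -/
theorem GeometricModelFrobenioid.pull_injective {X Y : FinSubextCat K Kt} (σ : Y ⟶ X) :
    Function.Injective (M.ops.pull σ) := by
  intro x y h
  have h' := congrArg (M.monEquiv Y) h
  rw [M.monEquiv_natural, M.monEquiv_natural] at h'
  exact (M.monEquiv X).injective (Γ.pullPhi_injective σ h')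

/-- **Theorem 6.2 (i)** (typed over the interfaces): a dominant `ψ : V₂ → V₁` with (a) `D_{K₂}` = primes mapping
into `D_{K₁}`, (b) `K₁ ↪ K₂ ↪ K̃₂` factoring through `K̃₁`, (c) `K₁` separably closed in `K₂`, "induces a functor
`Ψ : C₁ → C₂` [well-defined up to isomorphism] that is compatible with Frobenius degrees, the functor
`D₁ → D₂` induced by `K₁ ↪ K₂`, and the natural transformations `Φ₁ → Φ₂|_{D₁}`, `B₁ → B₂|_{D₁}`" (FrdI
pp. 110–111). The scheme-theoretic input `ψ` with (a)–(c) is abstracted into the induced base functor `βψ` and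
divisor pull-back `φψ` (PARAMETERS; the compatibility with `B₁ → B₂|_{D₁}` is not expressible over the
operations `(Base, Div, deg_Fr)` and is not rendered). SCHEMA (W2-8 (5)) over `M`, `M₂`, `βψ`, `φψ` — faithful to
print only when instantiated with THE data induced by `ψ` on the constructed models (abc-iut-L6-t10); not a
closed citable fact. [cite: MochizukiFrdI2008, Thm. 6.2 (i) p.110] -/
def Thm62i {K₂ : Type} [Field K₂] {Kt₂ : Type} [Field Kt₂] [Algebra K₂ Kt₂] [IsGalois K₂ Kt₂]
    {Γ₂ : GeometricDivisorData K₂ Kt₂} {C₂ : Type u} [Category.{v} C₂] (M₂ : GeometricModelFrobenioid Γ₂ C₂)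
    (βψ : FinSubextCat K Kt ⥤ FinSubextCat K₂ Kt₂)
    (φψ : ∀ X : FinSubextCat K Kt, M.ops.Mon X →* M₂.ops.Mon (βψ.obj X)) : Prop :=
  ∃ (Ψ : C ⥤ C₂) (η : Ψ ⋙ M₂.ops.base ≅ M.ops.base ⋙ βψ),
    (∀ ⦃A B : C⦄ (f : A ⟶ B), M₂.ops.degFr (Ψ.map f) = M.ops.degFr f) ∧
      ∀ ⦃A B : C⦄ (f : A ⟶ B), M₂.ops.div (Ψ.map f) = M₂.ops.pull (η.hom.app A) (φψ _ (M.ops.div f))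

/-! ### Theorem 6.2 (ii) (FrdI p. 111): "in characteristic `p` the Frobenius morphism `ψ : V → V` satisfies
the conditions of (i), hence determines `Ψ : C → C`, isomorphic to the naive Frobenius functor of degree `p`".
Interface-level data: `GeometricDivisorData.frobeniusPhi` / `frobeniusB` / `div_frobeniusB`; the isomorphism is
`Thm62ii` (+ `Thm62ii_holds`) in abc-iut-L6-t10's `GeometricFrobenioidModel.lean` over the CONSTRUCTED model
`geomFrobenioid Γ`; v1's parametric `Thm62ii` (both functors free; FLAG #14) is withdrawn.
[cite: MochizukiFrdI2008, Thm. 6.2 (ii) p.111] -/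

/-- **Theorem 6.2 (iii)** (typed): `C` is of isotropic, standard and birationally Frobenius-normalized type
(the last over birationalization data `Bi`, Prop. 4.4) but not of group-like type; and if every `D ∈ D_L`
lies in the support of the divisor of some element of `B(L)`, then `C` is of rationally standard type
(structured: `IsOfRationallyStandardType R` over explicit parameters `R : RSParams`) (FrdI p. 111).
SCHEMA (W2-8 (5)) over the data-only parameters `M`, `Bi`, `R` — faithful to print only when instantiated with
THE model `geomModelFrobenioid Γ` (abc-iut-L6-t10), THE birationalization (abc-iut-L1-t5 `biratSubfunctor` /
abc-iut-L6-t8 `PreFrobenioid.Birat`) and THE realification parameters; not a closed citable fact.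
[cite: MochizukiFrdI2008, Thm. 6.2 (iii) p.111] -/
def Thm62iii (Bi : M.ops.BiratData) (R : M.ops.RSParams) : Prop :=
  M.ops.IsOfIsotropicType ∧ M.ops.IsOfStandardType ∧ PreFrobenioidData.IsOfBiratFrobeniusNormalizedType Bi ∧
    ¬ M.ops.IsOfGroupLikeType ∧
    ((∀ (X : FinSubextCat K Kt) (P : Γ.primeDiv X), ∃ f : Γ.B X,
        (Multiplicative.toAdd (Γ.div X f)) P ≠ 0) → M.ops.IsOfRationallyStandardType R)

/-- **Theorem 6.2 (iv)** (typed): `D` is Frobenius-slim; with `Z ⊆ G` the elements commuting with some open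
subgroup, `D` is slim iff `Z = {1}`, and `D` is Div-slim iff every `1 ≠ z ∈ Z` acts nontrivially on `Φ(L)`
for some finite Galois `L ⊆ K̃` over `K` (FrdI p. 111). [cite: MochizukiFrdI2008, Thm. 6.2 (iv) p.111] -/
def Thm62iv : Prop :=
  IsFrobeniusSlim (FinSubextCat K Kt) ∧
    (IsSlim (FinSubextCat K Kt) ↔ commOpenSubgroup K Kt = {1}) ∧
    (M.ops.IsDivSlim ↔
      ∀ z ∈ commOpenSubgroup K Kt, z ≠ 1 →
        ∃ (X : FinSubextCat K Kt) (_ : IsGalois K X.L) (σ : X ⟶ X),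
          (∀ a : X.L, ((σ.toAlgHom a : X.L) : Kt) = z ((a : X.L) : Kt)) ∧ ∃ x : M.ops.Mon X, M.ops.pull σ x ≠ x)

end Thm62

end Literature.AlgebraicGeometry.Frobenioids

end
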